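import Literature.NumberTheory.LFunctions.YoshidaWindowGramColumnData
import HarnessLib

/-!
# C∞ rung `R1E` (even sector) — DATA `ENT` part 1/1

Route context: Fourier–Galerkin / Schur-complement certificates of Weil positivity on a window ("format C", C∞ door `weilPositivityOn_of_cinf_pipeline`); supporting stmt-RiemannHypothesis-0098; seat rh-explicit-weil-2 (`cinfemit.py`/`emit_lean2.py`, HOME/rh-explicit-weil-2/gen17/EMITTER-PHASE2.md). Data / bookkeeping only; standard axioms; no RH claim.
-/

set_option autoImplicit false
-- `Summit.RiemannHypothesis.RiemannHypothesis.…` is the layout-mandated namespace (summit = problem name).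
set_option linter.dupNamespace false

namespace Summit.RiemannHypothesis.RiemannHypothesis.Theorems.WeilFormatC

open Literature.NumberTheory.LFunctions

namespace CinfR1E

/-- Packed rows part 1/1 of table `ENT` (word width 247, 4 words). -/
def ENT_P : List ℕ := [
  0x7ffffffe06d38ad9afa4e4df36d3792d58815d198f73fad4c4f24349ae9f0f00000002470252798958641c0f9dda55078894ae213926db051bea463edd6dffffffffdf2ec8466e7e50a36e1673594569c23a8a031fec168321ad0e501500000001fe49a356dc6f0fe0f81dff87bfac5704e455d2c646500fa68c1aa,
  0x7fffffffff88e63a2dc8eb1c6e8da73460612bee737d3c77422dd349ee388f00000000001be9aee84fac74e52c392a9628a1ed81108c16e487574e4932767ffffffffff07ba12e049cbec4dada8a7fa76690eaf90765a8014a9a0e32f3ffffffffbe5d908cdcfca146dc2ce6b28ad3847514063fd82d06435a1ca02,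
  0x7ffffffffffff6f289ed86e64c412a383aa38408f61272f4f07523fe66c3c140000000000000db297f5188b2e5cc63664496195f08527a685ad66c605282000000000037d35dd09f58e9ca5872552c5143db0221182dc90eae9c9264ec000000091c0949e6256190703e7769541e2252b884e49b6c146fa918fb75b,
  0xa00000000000001ed2a830bfc53031db89247530bc50d50068a9a61daa0ad8ffffffffffffede513db0dcc9882547075470811ec24e5e9e0ea47fccd8781fffffffffe2398e8b723ac71ba369cd18184afb9cdf4f1dd08b74d27b8e23bfffffff0369c56cd7d2726f9b69bc96ac40ae8cc7b9fd6a627921a4d74f87]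

end CinfR1E

end Summit.RiemannHypothesis.RiemannHypothesis.Theorems.WeilFormatC
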